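import Literature.AlgebraicGeometry.Frobenioids.DivisorMonoidCategoryTheoreticityProofs
import Literature.AlgebraicGeometry.Frobenioids.ElementaryIsFrobenioid
import Literature.AlgebraicGeometry.Frobenioids.ElementaryIsomorphisms
import Literature.AlgebraicGeometry.Frobenioids.ElementaryIsos
import Literature.AlgebraicGeometry.Frobenioids.PerfectionPrimes
import HarnessLib

/-!
# Frobenioids I, Prop. 4.1 (iii) (criterion) as the schema `Prop41iii_criterion S DisjointSupp`: the
# universal closure over the FREE support-disjointness predicate is false — at a genuine Frobenioid

Mochizuki, *The geometry of Frobenioids I: the general theory*, Kyushu J. Math. **62** (2008) 293–400,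
§4, Proposition 4.1 (iii), kurims p. 75: "`ε_*(Div(ε))`, `ι_*(Div(ι)) ∈ Φ(F)` have disjoint supports
[cf. Definition 2.4, (i), (d)] if and only if `ε`, `ι` are co-primary" [cite: MochizukiFrdI2008, Prop. 4.1 (iii) p.75].

PROOF-ONLY companion (no definitions, no instances) of `DivisorMonoidCategoryTheoreticityDefs.lean` (seat
abc-iut-L1-t3); cell abc-iut, block F, seat abc-iut-f-045.  FACT-LIST row **F-1040**
`PreFrobenioidData.Prop41iii_criterion S DisjointSupp`.  The support `Supp` of [FrdI] Def. 2.4 (i)(d) is a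
§2 notion not owned by the typing seat, so the decl takes "the supports of `y_ε`, `y_ι` are disjoint" as a
FREE PARAMETER `DisjointSupp : Φ(X) → Φ(X) → Prop` (its docstring says so); the instance of record binds
it to the honest disjointness — `PreFrobenioidData.prop41iii_criterion_holds (hF : IsFrobenioid F) (hpf)`
with `DisjointSupp :=` disjointness of Def. 2.4 supports (`DivisorMonoidCategoryTheoreticityProofs.lean`).
The R7 kernel TYPE-audit (abc-iut-w5-d199 v2: «[binders 8 vs 6; Prop-hyps: IsFrobenioid, Objectwise]»)
found no theorem over ALL `(S, DisjointSupp)`, and there is none: as soon as the antecedent is met ONCE —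
a pre-Frobenioid of perfect and isotropic type with a step `ε` — the two instantiations `DisjointSupp := ⊤`
and `DisjointSupp := ⊥` contradict each other (`⊤ ↔ co-primary(ε, ε) ↔ ⊥`).  Witness (GENUINE, not junk):
the elementary Frobenioid `F_Φ → F_{Φ^char}` ([FrdI] Prop. 1.5) of the constant perfect monoid
`Φ = ℝ_{≥0}` on the one-object base (perfect type by Prop. 1.5 (iii), `ElemFrobenioid.isOfPerfectType`;
isotropic type by `ElemFrobenioid.isIsotropic`), with the step `ε = (id, 1, 1)` (linear, base-identity, not
invertible since its zero divisor `1 ∈ ℝ_{≥0}` is not a unit).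
* `not_forall_prop41iii_criterion` — the universal closure of F-1040 (level `0`) is FALSE.
So the row is admissible AT THE NAMED INSTANCE ONLY (R5: `prop41iii_criterion_holds`, honest supports).
Refuted-closure ≠ refuted-paper (the paper's predicate is the honest one); a FACT row is an assumption
label, not an endorsement; nothing here bears on [IUTchIII] Cor. 3.12.
-/

noncomputable section

namespace Literature.AlgebraicGeometry.Frobenioids

open CategoryTheory Opposite

/-- `1 ∈ ℝ_{≥0}` (written multiplicatively) is not a unit. [folklore] -/
private theorem not_isUnit_ofAdd_one_nnreal : ¬ IsUnit (Multiplicative.ofAdd (1 : NNReal)) := by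
  rintro ⟨u, hu⟩
  have h : Multiplicative.toAdd (u : Multiplicative NNReal) + Multiplicative.toAdd (↑u⁻¹ : Multiplicative NNReal) = 0 := by
    rw [← toAdd_mul, Units.mul_inv, toAdd_one]
  rw [hu, toAdd_ofAdd] at h
  exact one_ne_zero (add_eq_zero.mp h).1

/-- **FACT-LIST F-1040, universal closure REFUTED** (universe `0`).  In the elementary Frobenioid of the
constant monoid `ℝ_{≥0}` on the one-object base (perfect and isotropic type), `ε = (id, 1, 1)` is a step with
`(Base ε)^* (Div ε) = Div ε`; the schema at `DisjointSupp := ⊤` and at `DisjointSupp := ⊥` gives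
`⊤ ↔ IsCoprimary ε ε ↔ ⊥`.  Instance of record: `PreFrobenioidData.prop41iii_criterion_holds`
(every Frobenioid with perf-factorial `Φ`, honest supports). [cite: MochizukiFrdI2008, Prop. 4.1 (iii) p.75] -/
theorem not_forall_prop41iii_criterion :
    ¬ ∀ (C : Type) [Category.{0} C] (D : Type) [Category.{0} D] (S : PreFrobenioidData.{0} C D)
        (DisjointSupp : ∀ {X : D}, S.Mon X → S.Mon X → Prop), S.Prop41iii_criterion DisjointSupp := by
  intro h
  let Φ : (Discrete Unit)ᵒᵖ ⥤ CommMonCat.{0} := (Functor.const _).obj (CommMonCat.of (Multiplicative NNReal))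
  let S : PreFrobenioidData.{0} (ElemFrobenioid Φ) (Discrete Unit) :=
    PreFrobenioidData.ofFunctor (charFunctor Φ) (ElemFrobenioid.toChar Φ)
  have hperf : S.IsOfPerfectType :=
    (PreFrobenioidData.ofFunctor_isOfPerfectType (ElemFrobenioid.toChar Φ)).mpr
      (ElemFrobenioid.isOfPerfectType fun _ => isPerfect_multiplicative_nnreal)
  have hiso : S.IsOfIsotropicType :=
    (PreFrobenioidData.ofFunctor_isOfIsotropicType (ElemFrobenioid.toChar Φ)).mpr
      fun A => ElemFrobenioid.isIsotropic A
  let A : ElemFrobenioid Φ := (⟨()⟩ : Discrete Unit)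
  let ε : A ⟶ A := ElemFrobenioid.homMk (𝟙 A.base) (Multiplicative.ofAdd (1 : NNReal)) 1
  have hstep : S.IsStep ε := by
    refine (PreFrobenioidData.ofFunctor_isStep (ElemFrobenioid.toChar Φ) ε).mpr ⟨⟨rfl, ?_⟩, fun hI => ?_⟩
    · change IsIso (ElemFrobenioid.Base ε)
      rw [ElemFrobenioid.base_homMk]
      infer_instance
    · have hu := ElemFrobenioid.isUnit_div_of_isIso ε
      rw [ElemFrobenioid.div_homMk] at hu
      exact not_isUnit_ofAdd_one_nnreal hu
  have hpull : S.pull (S.base.map ε) (S.div ε) = S.div ε := by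
    have hb : S.base.map ε = 𝟙 _ := Subsingleton.elim _ _
    rw [hb, S.pull_id]
  have h1 := h _ _ S (fun _ _ => True) hperf hiso ε ε hstep hstep _ _ hpull hpull
  have h2 := h _ _ S (fun _ _ => False) hperf hiso ε ε hstep hstep _ _ hpull hpull
  exact h2.mpr (h1.mp trivial)

end Literature.AlgebraicGeometry.Frobenioids

end
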